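import Literature.AlgebraicGeometry.Motives.AbelianVarietyEquivariantQuasiDecomposition
import Literature.AlgebraicGeometry.Motives.AbelianVarietyPoincareEquivariantPerfectField
import HarnessLib

/-!
# Decomposition up to isogeny into `R`-simple pieces, with complex multiplication, over a perfect field

Instance of the engine `AbelianVariety.exists_equivariant_quasiDecomposition_of_splitting`
(`Motives/AbelianVarietyEquivariantQuasiDecomposition`) at the equivariant Poincaré complements
of `Motives/AbelianVarietyPoincareEquivariantPerfectField`: over a PERFECT field `K`, for a
commutative ring `R` generated up to isogeny by one element `α` (`m r ∈ ℤ[α]`, `m ≠ 0`, for every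
`r`) with `f(α) = 0` for an integral polynomial `f` admitting a certificate `c_u f + c_v f' = D ≠ 0`
— e.g. an order of a CM field acting by complex multiplication —

* `AbelianVariety.exists_equivariant_quasiDecomposition_of_generator` — **every abelian variety
  `X` with `R`-action `φ : R →+* End X` decomposes up to isogeny, EQUIVARIANTLY, into finitely
  many `R`-SIMPLE abelian varieties `(Sᵢ, χᵢ)`**: equivariant `ιᵢ : Sᵢ ⟶ X`, `πᵢ : X ⟶ Sᵢ` and
  `N ≥ 1` with `ιᵢ ≫ πᵢ = N`, `ιᵢ ≫ πⱼ = 0` (`i ≠ j`), `∑ᵢ πᵢ ≫ ιᵢ = N` (Mumford §19 Thm. 1 and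
  Cor. 1 with complex multiplication: the isogeny factors of a CM abelian variety with their
  induced `R`-action);
(private bookkeeping `corners_of_quasiInverse_biprod`: the four corners `j ≫ t = M`, `i ≫ t = 0`,
`j ≫ h = 0`, `h ≫ i + t ≫ j = M` of a quasi-inverse pair `(i, j) : Y ⊞ Z ⟶ X`,
`(h, t) : X ⟶ Y ⊞ Z`).

Everything is proved; no definition, no named fact (D-0026).

## References

* D. Mumford, *Abelian Varieties* (1970), §19 Thm. 1 and Cor. 1 (pp. 173–174). [MumfordAV1970]
* J. S. Milne, *Abelian Varieties*, in Cornell–Silverman (eds.), *Arithmetic Geometry* (1986),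
  Prop. 12.1 (p. 122). [Milne1986AbelianVarieties]
-/

noncomputable section

universe u v

open CategoryTheory CategoryTheory.Limits AlgebraicGeometry Polynomial

namespace Literature.AlgebraicGeometry.Motives

namespace AbelianVariety

variable {K : Type u} [Field K]

/-- **Corners of a quasi-inverse pair through a biproduct.** If `(h, t) ≫ (i, j) = M • 𝟙 X` and
`(i, j) ≫ (h, t) = M • 𝟙 (Y ⊞ Z)` for `i : Y ⟶ X`, `j : Z ⟶ X`, `h : X ⟶ Y`, `t : X ⟶ Z`, then
`j ≫ t = M • 𝟙 Z`, `i ≫ t = 0`, `j ≫ h = 0` and `h ≫ i + t ≫ j = M • 𝟙 X` (and `i ≫ h = M • 𝟙 Y`,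
the upper left corner, likewise). [folklore] -/
private theorem corners_of_quasiInverse_biprod {X Y Z : AbelianVariety K} {i : Y ⟶ X} {j : Z ⟶ X}
    {h : X ⟶ Y} {t : X ⟶ Z} {M : ℕ} (h1 : biprod.lift h t ≫ biprod.desc i j = M • 𝟙 X)
    (h2 : biprod.desc i j ≫ biprod.lift h t = M • 𝟙 (Y ⊞ Z)) :
    j ≫ t = M • 𝟙 Z ∧ i ≫ t = 0 ∧ j ≫ h = 0 ∧ h ≫ i + t ≫ j = M • 𝟙 X := by
  have e2 : ∀ (W W' : AbelianVariety K) (a : W ⟶ Y ⊞ Z) (b : Y ⊞ Z ⟶ W'),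
      a ≫ (biprod.desc i j ≫ biprod.lift h t) ≫ b = M • (a ≫ b) := fun _ _ a b ↦ by
    rw [h2, Preadditive.nsmul_comp, Category.id_comp, Preadditive.comp_nsmul]
  refine ⟨?_, ?_, ?_, ?_⟩
  · have e := e2 _ _ biprod.inr biprod.snd
    rwa [Category.assoc, biprod.inr_desc_assoc, biprod.lift_snd, biprod.inr_snd] at e
  · have e := e2 _ _ biprod.inl biprod.snd
    rwa [Category.assoc, biprod.inl_desc_assoc, biprod.lift_snd, biprod.inl_snd, smul_zero] at e
  · have e := e2 _ _ biprod.inr biprod.fst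
    rwa [Category.assoc, biprod.inr_desc_assoc, biprod.lift_fst, biprod.inr_fst, smul_zero] at e
  · rwa [biprod.lift_desc] at h1

variable [PerfectField K]

/-- **Decomposition up to isogeny into `R`-simple pieces, with complex multiplication by an
order, over a perfect field.** Let `R` be a commutative ring generated up to isogeny by one
element `α` — every `r ∈ R` has `m r = p(α)` for some integer `m ≠ 0` and `p ∈ ℤ[T]` — with
`f(α) = 0` for an integral polynomial `f` admitting a certificate `c_u f + c_v f' = D`, `D ≠ 0`
(e.g. `R` an order of the number field `ℚ(α)`; for `R = 𝓞_K` all of this is discharged in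
`Motives/AbelianVarietyPoincareEquivariantRingOfIntegers`).  Then every abelian variety `X` over a
perfect field with `R`-action `φ : R →+* End X` admits finitely many abelian varieties `Sᵢ` with
`R`-actions `χᵢ : R →+* End Sᵢ`, each **`R`-simple** (no abelian variety `W` with `R`-action and
equivariant closed immersion `W ↪ Sᵢ` of dimension `0 < dim W < dim Sᵢ`), EQUIVARIANT morphisms
`ιᵢ : Sᵢ ⟶ X`, `πᵢ : X ⟶ Sᵢ` (`ιᵢ ≫ φ r = χᵢ r ≫ ιᵢ`, `φ r ≫ πᵢ = πᵢ ≫ χᵢ r`) and `N ≥ 1` with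
`ιᵢ ≫ πᵢ = N • 𝟙`, `ιᵢ ≫ πⱼ = 0` for `i ≠ j`, `∑ᵢ πᵢ ≫ ιᵢ = N • 𝟙 X` — `X` is `R`-equivariantly
isogenous to `⊕ᵢ Sᵢ`. [cite: MumfordAV1970, §19 Thm. 1 and Cor. 1 (pp. 173–174)]
[cite: Milne1986AbelianVarieties, Prop. 12.1 (p. 122)] -/
theorem exists_equivariant_quasiDecomposition_of_generator {R : Type v} [CommRing R] (α : R)
    (f cu cv : Polynomial ℤ) (D : ℤ) (hD : D ≠ 0) (hf : aeval α f = 0)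
    (hcert : cu * f + cv * derivative f = C D)
    (hgen : ∀ r : R, ∃ (m : ℕ) (p : Polynomial ℤ), m ≠ 0 ∧ (m : R) * r = aeval α p)
    (X : AbelianVariety K) (φ : R →+* End X) :
    ∃ (I : Type) (_ : Fintype I) (S : I → AbelianVariety K) (χ : ∀ i, R →+* End (S i))
      (ι : ∀ i, S i ⟶ X) (π : ∀ i, X ⟶ S i) (N : ℕ),
      (∀ i, ∀ (W : AbelianVariety K) (ω : R →+* End W) (w : W ⟶ S i),
        IsClosedImmersion (Hom.toSchemeHom w) →
        (∀ r : R, w ≫ End.asHom (χ i r) = End.asHom (ω r) ≫ w) →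
        0 < W.dim → W.dim < (S i).dim → False) ∧
      0 < N ∧ (∀ i, ι i ≫ π i = N • 𝟙 (S i)) ∧ (∀ i j, i ≠ j → ι i ≫ π j = 0) ∧
      ∑ i, π i ≫ ι i = N • 𝟙 X ∧
      (∀ i (r : R), ι i ≫ End.asHom (φ r) = End.asHom (χ i r) ≫ ι i) ∧
      (∀ i (r : R), End.asHom (φ r) ≫ π i = π i ≫ End.asHom (χ i r)) := by
  refine exists_equivariant_quasiDecomposition_of_splitting (fun X φ Y ψ i hci hi h0 _ ↦ ?_) X φ
  obtain ⟨h, M, Z, χ, j, t, hM, hih, hh, -, -, -, hdim, h1, h2, hχj, hχt⟩ :=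
    exists_equivariant_complement_of_generator φ ψ i hi α f cu cv D hD hf hcert hgen
  obtain ⟨hjt, hit, hjh, htot⟩ := corners_of_quasiInverse_biprod h1 h2
  exact ⟨Z, χ, j, h, t, M, by omega, Nat.pos_of_ne_zero hM, hih, hjt, hit, hjh, htot,
    fun r ↦ (hχj r).symm, hh, fun r ↦ (hχt r).symm⟩

end AbelianVariety

end Literature.AlgebraicGeometry.Motives

end
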